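import Summits.RiemannHypothesis.RiemannHypothesis.Theorems.PfPersistenceDilationOrbit
import HarnessLib

/-!
# Lemma S: one-sided slope bounds of the window energy along window sequences, with a limiting
# ground state (pub-rhpf, theory-1 gen 9; helper for crux `EvenSectorBarta.EvenOneSignedWindows`,
# item stmt-RiemannHypothesis-19953; RH-free)

**mechanism/rigidity campaign; no RH claims.**  Companion text:
`run/shared/lean/pub/pub-rhpf/pub-rhpf-theory-1/THEORY-EDGE-9.md`.

`exists_isWeilGroundState_slope_bound` (PROVED): for a window `0 < a ≤ L < ½ log 2` and windows
`bₙ → a` in `(0, L]` with `bₙ ≠ a` there are a ground state `u` of the window `a`, a subsequence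
`φ` and reals `rₙ → −V(u)/a` (`V = weilSmallWindowVirial a`) with
`(b_{φ n} − a)(slope ε (a, b_{φ n}) − rₙ) ≥ 0` for every `n` (`ε = weilGroundEnergy`): the
difference quotients of the bottom from the right are eventually bounded BELOW, and from the left
bounded ABOVE, by quantities converging to `−V(u)/a` for a ground state `u` produced by the
sequence. This is the lower half of Danskin's theorem for the min-function
`ε(b) = min_g Re Q(g)`; the upper half is the Dini envelope bound of `PfPersistenceEdgeLawDini`;
together they give the one-sided window derivatives (`PfPersistenceWindowDanskin`).

Construction: unit near-minimisers `gₙ` of the windows `bₙ` with precision `(bₙ − a)²`, dilated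
into the window `a` (`ηₙ = bₙ/a − 1`): `ε(a) ≤ Re Q((gₙ)_{ηₙ}) = Re Q(gₙ) + ηₙ 𝒱((gₙ)_{ξₙ})/(1+ξₙ)`
(orbit mean value) and `Re Q(gₙ) < ε(bₙ) + (bₙ − a)²`. The dilates `(gₙ)_{ηₙ}` are minimising for
the window `a` (window continuity of `ε` and the uniform cost of small dilations); the
Connes–Consani–Moscovici compactness gives an `L²`-convergent subsequence, whose limit is a ground
state `u`; the intermediate dilates `(gₙ)_{ξₙ}` converge to the same `u` (strong continuity of the
dilation group), and the closed virial is continuous along such sequences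
(`tendsto_weilFormVirial_of_window`), while on tests it is Bombieri's virial and on ground states
it is `weilSmallWindowVirial` (`PfPersistenceFormVirial`).

References: J. M. Danskin, SIAM J. Appl. Math. 14 (1966) 641–664, Thm 1; T. Kato, *Perturbation
Theory for Linear Operators* (1966), VII §4; A. Connes, C. Consani, H. Moscovici (2025), Thm 3.6.
-/

set_option linter.dupNamespace false

noncomputable section

open MeasureTheory Set Filter Metric
open scoped Topology

namespace Summit.RiemannHypothesis.RiemannHypothesis.Theorems.PfPersistence

open Literature.NumberTheory.LFunctions

/-! ## Lemma S: one-sided slope bounds of the bottom along window sequences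

For windows `bₙ → a` (`bₙ ≠ a`, all in `(0, L]`, `a ≤ L < ½ log 2`) take unit near-minimisers
`gₙ` of the windows `bₙ` with precision `(bₙ − a)²` and dilate them into the window `a`
(`ηₙ = bₙ/a − 1`): `ε(a) ≤ Re Q((gₙ)_{ηₙ}) = Re Q(gₙ) + ηₙ 𝒱((gₙ)_{ξₙ})/(1+ξₙ)` (mean value) and
`Re Q(gₙ) < ε(bₙ) + (bₙ − a)²`, so `(bₙ − a)(slope ε (a, bₙ) − rₙ) ≥ 0` with
`rₙ = −𝒱((gₙ)_{ξₙ})/((1+ξₙ)a) − (bₙ − a)`. The dilates `(gₙ)_{ηₙ}` are minimising for the window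
`a`; by the Connes–Consani–Moscovici compactness a subsequence converges in `L²` to a ground state
`u`, the `(gₙ)_{ξₙ}` converge to the same `u` (strong continuity of the dilation group), and by
the continuity of the closed virial `r_{φ(n)} → −V(u)/a`. -/

/-- **Lemma S.** See the section docstring. [cite: Danskin1966, Thm 1; Kato1966, VII §4] -/
theorem exists_isWeilGroundState_slope_bound {a L : ℝ} (ha : 0 < a) (haL : a ≤ L)
    (hL : L < Real.log 2 / 2) {b : ℕ → ℝ} (hb0 : ∀ n, 0 < b n) (hbL : ∀ n, b n ≤ L)
    (hba : ∀ n, b n ≠ a) (hb : Tendsto b atTop (𝓝 a)) :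
    ∃ (u : ℝ → ℂ) (φ : ℕ → ℕ) (r : ℕ → ℝ), IsWeilGroundState a u ∧ StrictMono φ ∧
      Tendsto r atTop (𝓝 (-weilSmallWindowVirial a u / a)) ∧
      ∀ n, 0 ≤ (b (φ n) - a) * (slope weilGroundEnergy a (b (φ n)) - r n) := by
  have hL0 : 0 < L := ha.trans_le haL
  have ha' : a ≠ 0 := ha.ne'
  -- (1) near-minimisers of the windows `b n`
  have hδ : ∀ n, 0 < (b n - a) ^ 2 := fun n ↦ by
    have : b n - a ≠ 0 := sub_ne_zero.2 (hba n)
    positivity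
  choose g hg hgs hgn hgQ using fun n ↦ exists_re_weilQuadratic_lt (hb0 n) (hδ n)
  have hgL : ∀ n, tsupport (g n) ⊆ Icc (-L) L := fun n ↦
    (hgs n).trans (Icc_subset_Icc (neg_le_neg (hbL n)) (hbL n))
  -- (2) dilation parameters into the window `a`
  obtain ⟨η, hηdef⟩ : ∃ η : ℕ → ℝ, ∀ n, η n = b n / a - 1 := ⟨_, fun _ ↦ rfl⟩
  have hη1 : ∀ n, -1 < η n := fun n ↦ by rw [hηdef]; linarith [div_pos (hb0 n) ha]
  have hηpos : ∀ n, 0 < 1 + η n := fun n ↦ by linarith [hη1 n]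
  have hηba : ∀ n, η n = (b n - a) / a := fun n ↦ by rw [hηdef]; field_simp
  have hη0 : ∀ n, η n ≠ 0 := fun n h ↦ by
    rw [hηba, div_eq_zero_iff] at h
    exact h.elim (sub_ne_zero.2 (hba n)) ha'
  have hηa : ∀ n, b n / (1 + η n) = a := fun n ↦ by
    have e : 1 + η n = b n / a := by rw [hηdef]; ring
    rw [e, div_div_eq_mul_div, mul_comm, mul_div_assoc, div_self (hb0 n).ne', mul_one]
  -- (3) mean values
  choose ξ hξlo hξhi hMVT using fun n ↦
    exists_re_weilQuadratic_weilDilate_sub_eq (hg n) (hη1 n) (hη0 n)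
  have hξ1 : ∀ n, -1 < ξ n := fun n ↦ (lt_min (by norm_num) (hη1 n)).trans (hξlo n)
  have hξpos : ∀ n, 0 < 1 + ξ n := fun n ↦ by linarith [hξ1 n]
  have hξabs : ∀ n, |ξ n| < |η n| := fun n ↦ abs_lt.2
    ⟨(le_min (neg_nonpos.2 (abs_nonneg _)) (neg_abs_le _)).trans_lt (hξlo n),
     (hξhi n).trans_le (max_le (abs_nonneg _) (le_abs_self _))⟩
  have hcL : ∀ n, b n / (1 + ξ n) ≤ L := by
    intro n
    rcases le_or_gt 0 (ξ n) with h0 | h0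
    · exact (div_le_self (hb0 n).le (by linarith)).trans (hbL n)
    · have hmin : min 0 (η n) < 0 := (hξlo n).trans h0
      have hηneg : η n < 0 := by
        rcases min_lt_iff.1 hmin with h | h
        · exact absurd h (lt_irrefl 0)
        · exact h
      have hηξ : η n < ξ n := by
        have := hξlo n
        rwa [min_eq_right hηneg.le] at this
      have h1 : b n / (1 + ξ n) < b n / (1 + η n) :=
        div_lt_div_of_pos_left (hb0 n) (hηpos n) (by linarith)
      rw [hηa] at h1
      exact h1.le.trans haL
  -- (4) the two dilated families: `k n` (mean-value points) and `h n` (window `a`)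
  obtain ⟨k, hkdef⟩ : ∃ k : ℕ → ℝ → ℂ, ∀ n, k n = weilDilate (ξ n) (g n) := ⟨_, fun _ ↦ rfl⟩
  obtain ⟨h, hhdef⟩ : ∃ h : ℕ → ℝ → ℂ, ∀ n, h n = weilDilate (η n) (g n) := ⟨_, fun _ ↦ rfl⟩
  have hk : ∀ n, IsWeilTest (k n) ∧ tsupport (k n) ⊆ Icc (-L) L ∧
      ∫ t, ‖k n t‖ ^ 2 = (1 : ℝ) := fun n ↦ by
    refine ⟨?_, ?_, ?_⟩
    · rw [hkdef]; exact (hg n).weilDilate (hξ1 n)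
    · rw [hkdef]
      exact (tsupport_weilDilate_subset (g n) (hξ1 n) (hgs n)).trans
        (Icc_subset_Icc (neg_le_neg (hcL n)) (hcL n))
    · rw [hkdef, integral_norm_sq_weilDilate _ (hξ1 n), hgn n]
  have hh : ∀ n, IsWeilTest (h n) ∧ tsupport (h n) ⊆ Icc (-a) a ∧
      ∫ t, ‖h n t‖ ^ 2 = (1 : ℝ) := fun n ↦ by
    refine ⟨?_, ?_, ?_⟩
    · rw [hhdef]; exact (hg n).weilDilate (hη1 n)
    · have := tsupport_weilDilate_subset (g n) (hη1 n) (hgs n)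
      rwa [hηa, ← hhdef] at this
    · rw [hhdef, integral_norm_sq_weilDilate _ (hη1 n), hgn n]
  -- (5) the slope inequality, for every `n`
  obtain ⟨W, hWdef⟩ : ∃ W : ℕ → ℝ, ∀ n, W n = weilDilationVirial (k n) / (1 + ξ n) :=
    ⟨_, fun _ ↦ rfl⟩
  obtain ⟨r, hrdef⟩ : ∃ r : ℕ → ℝ, ∀ n, r n = -W n / a - (b n - a) := ⟨_, fun _ ↦ rfl⟩
  have hineq : ∀ n, 0 ≤ (b n - a) * (slope weilGroundEnergy a (b n) - r n) := by
    intro n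
    have h1 : weilGroundEnergy a ≤ (weilQuadratic (h n)).re :=
      weilGroundEnergy_le_re_weilQuadratic (hh n).1 (hh n).2.1 (hh n).2.2
    have h2 : (weilQuadratic (g n)).re < weilGroundEnergy (b n) + (b n - a) ^ 2 := hgQ n
    have h3 : (weilQuadratic (h n)).re - (weilQuadratic (g n)).re = η n * W n := by
      rw [hWdef, hhdef, hkdef]; exact hMVT n
    have h4 : η n * W n = (b n - a) / a * W n := by rw [hηba]
    have hne : b n - a ≠ 0 := sub_ne_zero.2 (hba n)
    rw [slope_def_field, hrdef]
    have e : (b n - a) * ((weilGroundEnergy (b n) - weilGroundEnergy a) / (b n - a) -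
        (-W n / a - (b n - a))) = weilGroundEnergy (b n) - weilGroundEnergy a +
        (b n - a) / a * W n + (b n - a) ^ 2 := by
      field_simp
      ring
    rw [e]
    linarith
  -- (6) convergences of the parameters and energies
  have hεb : Tendsto (fun n ↦ weilGroundEnergy (b n)) atTop (𝓝 (weilGroundEnergy a)) :=
    (continuousAt_weilGroundEnergy ha).tendsto.comp hb
  have hsq : Tendsto (fun n ↦ (b n - a) ^ 2) atTop (𝓝 0) := by
    have := (hb.sub_const a).pow 2
    simpa using this
  have hQg : Tendsto (fun n ↦ (weilQuadratic (g n)).re) atTop (𝓝 (weilGroundEnergy a)) := by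
    refine tendsto_of_tendsto_of_tendsto_of_le_of_le hεb ?_
      (fun n ↦ weilGroundEnergy_le_re_weilQuadratic (hg n) (hgs n) (hgn n))
      (fun n ↦ (hgQ n).le)
    simpa using hεb.add hsq
  have hE : ∀ᶠ n in atTop, (weilQuadratic (g n)).re ≤ weilGroundEnergy a + 1 :=
    hQg.eventually (Iic_mem_nhds (by linarith))
  have hη : Tendsto η atTop (𝓝 0) := by
    have h1 : Tendsto (fun n ↦ b n / a - 1) atTop (𝓝 (a / a - 1)) :=
      (hb.div_const a).sub_const 1
    rw [div_self ha', sub_self] at h1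
    exact h1.congr fun n ↦ (hηdef n).symm
  have hξ : Tendsto ξ atTop (𝓝 0) :=
    squeeze_zero_norm (a := fun n ↦ |η n|)
      (fun n ↦ by simpa only [Real.norm_eq_abs] using (hξabs n).le) (by simpa using hη.abs)
  have hQh : Tendsto (fun n ↦ (weilQuadratic (h n)).re) atTop (𝓝 (weilGroundEnergy a)) := by
    have h1 := hQg.add (tendsto_re_weilQuadratic_weilDilate_sub hL0
      (fun n ↦ ⟨hg n, hgL n, hgn n⟩) hE hη)
    rw [add_zero] at h1
    refine h1.congr fun n ↦ ?_
    rw [hhdef]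
    ring
  have hQk : Tendsto (fun n ↦ (weilQuadratic (k n)).re) atTop (𝓝 (weilGroundEnergy a)) := by
    have h1 := hQg.add (tendsto_re_weilQuadratic_weilDilate_sub hL0
      (fun n ↦ ⟨hg n, hgL n, hgn n⟩) hE hξ)
    rw [add_zero] at h1
    refine h1.congr fun n ↦ ?_
    rw [hkdef]
    ring
  -- (7) compactness: a ground state `u` of the window `a`, truncated to the open window
  obtain ⟨u₀, hu₀2, φ, hφ, hconv⟩ :=
    ConnesConsaniMoscovici2025_thm_3_6_holds a ha h hh hQh.bddAbove_range
  have hu₀ : IsWeilGroundState a u₀ :=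
    ⟨hu₀2, fun n ↦ h (φ n), fun n ↦ hh (φ n), hQh.comp hφ.tendsto_atTop, hconv⟩
  obtain ⟨u, hudef⟩ : ∃ u : ℝ → ℂ, u = weilTrunc a u₀ := ⟨_, rfl⟩
  have hu : IsWeilGroundState a u := hudef ▸ isWeilGroundState_weilTrunc hu₀
  have hu2 : MemLp u 2 := hu.memLp
  have hua : ∀ x, a ≤ |x| → u x = 0 := fun x hx ↦ by rw [hudef]; exact weilTrunc_eq_zero u₀ hx
  have huR : ∀ x, x ∉ Icc (-L) L → u x = 0 := fun x hx ↦ by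
    refine hua x (haL.trans ?_)
    rw [mem_Icc, not_and_or, not_le, not_le] at hx
    rcases hx with hx | hx
    · exact (lt_abs.2 (Or.inr (by linarith))).le
    · exact (lt_abs.2 (Or.inl hx)).le
  have hconvh : Tendsto (fun n ↦ ∫ t, ‖h (φ n) t - u t‖ ^ 2) atTop (𝓝 0) := by
    refine hconv.congr' (Eventually.of_forall fun n ↦ integral_congr_ae ?_)
    filter_upwards [ae_eq_weilTrunc hu₀] with t ht
    rw [hudef, ← ht]
  -- (8) the mean-value family converges to the same ground state
  obtain ⟨ζ, hζdef⟩ : ∃ ζ : ℕ → ℝ, ∀ n, ζ n = (1 + ξ n) / (1 + η n) - 1 := ⟨_, fun _ ↦ rfl⟩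
  have hζ1 : ∀ n, -1 < ζ n := fun n ↦ by rw [hζdef]; linarith [div_pos (hξpos n) (hηpos n)]
  have hζ : Tendsto ζ atTop (𝓝 0) := by
    have h1 := ((hξ.const_add 1).div (hη.const_add 1) (by norm_num)).sub_const 1
    norm_num at h1
    exact h1.congr fun n ↦ (hζdef n).symm
  have hkζ : ∀ n, k n = weilDilate (ζ n) (h n) := fun n ↦ by
    rw [hkdef, hhdef, weilDilate_weilDilate (η n) (hζ1 n)]
    congr 1
    have hne : 1 + η n ≠ 0 := (hηpos n).ne'
    rw [hζdef]
    field_simp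
    ring
  have hconvk : Tendsto (fun n ↦ ∫ t, ‖k (φ n) t - u t‖ ^ 2) atTop (𝓝 0) := by
    have h1 := tendsto_integral_norm_sq_weilDilate_seq_sub hu2 (fun n ↦ (hh (φ n)).1.memLp_two)
      hconvh (fun n ↦ hζ1 (φ n)) (hζ.comp hφ.tendsto_atTop)
    refine h1.congr fun n ↦ ?_
    rw [hkζ]
  -- (9) continuity of the closed virial
  have hVu : weilSmallWindowVirial a u = weilFormVirial u := by
    rw [weilSmallWindowVirial_eq_weilFormVirial hu2, weilTrunc_eq_self hua]
  have hVk : Tendsto (fun n ↦ weilFormVirial (k (φ n))) atTop (𝓝 (weilFormVirial u)) :=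
    tendsto_weilFormVirial_of_window (R := L) (N := 1) hu2 (fun n ↦ (hk (φ n)).1.memLp_two) huR
      (fun n x hx ↦ image_eq_zero_of_notMem_tsupport fun hm ↦ hx ((hk (φ n)).2.1 hm))
      (fun n ↦ (hk (φ n)).2.2.le) hconvk
  have hW : Tendsto (fun n ↦ W (φ n)) atTop (𝓝 (weilSmallWindowVirial a u)) := by
    have h1 := hVk.div ((hξ.comp hφ.tendsto_atTop).const_add 1) (by norm_num)
    rw [add_zero, div_one, ← hVu] at h1
    refine h1.congr fun n ↦ ?_
    rw [hWdef, weilDilationVirial_eq_weilFormVirial (hk (φ n)).1 hL0 hL (hk (φ n)).2.1]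
    rfl
  have hr : Tendsto (fun n ↦ r (φ n)) atTop (𝓝 (-weilSmallWindowVirial a u / a)) := by
    have h1 := (hW.neg.div_const a).sub ((hb.comp hφ.tendsto_atTop).sub_const a)
    rw [sub_self, sub_zero] at h1
    refine h1.congr fun n ↦ ?_
    rw [hrdef]
    rfl
  exact ⟨u, φ, fun n ↦ r (φ n), hu, hφ, hr, fun n ↦ hineq (φ n)⟩

end Summit.RiemannHypothesis.RiemannHypothesis.Theorems.PfPersistence

end
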